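import Mathlib.Analysis.LocallyConvex.HahnBanach
import Mathlib.Analysis.Normed.Operator.Banach
import Mathlib.LinearAlgebra.FiniteDimensional.Lemmas
import Literature.Analysis.OperatorTheory.PeetreLemma
import HarnessLib

/-!
# Upper semicontinuity of the nullity of a semi-Fredholm operator under small perturbations

Topic `Literature/Analysis/OperatorTheory`. T. Kato, *Perturbation Theory for Linear Operators*
(1966), Ch. IV §5.3 ("Other stability theorems"), **Thm. 5.22** (PDF p. 286): for `T` a
semi-Fredholm operator from `X` to `Y` and `A` a `T`-bounded perturbation with `T`-bound small
with respect to the reduced minimum modulus `γ(T)`, `S = T + A` is semi-Fredholm and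
`nul S ≤ nul T`, `def S ≤ def T`, `ind S = ind T` (the *first stability theorem*; the bounded
case "has long been known (Atkinson, Gohberg–Krein)", footnote PDF p. 286). This file proves the
NULLITY clause in the bounded, upper-semi-Fredholm case, in the elementary form in which it enters
Kodaira's semicontinuity theorem for `C^∞` families of elliptic operators (K. Kodaira, *Complex
Manifolds and Deformation of Complex Structures* (2005), Thm. 7.3: "`dim 𝔽_t` is upper
semicontinuous in `t`", whence the upper semicontinuity of the Hodge numbers `h^{p,q}(M_t)`,
Thm. 7.8 — the missing input of `AlgebraicGeometry/Motives/FiberNetExistenceProofs`):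

* `exists_bound_of_isCompl_ker` — a bounded operator `T : E → F` between Banach spaces with closed
  range is bounded below on every closed complement `M` of its kernel: `c‖x‖ ≤ ‖T x‖` on `M` for
  some `c > 0` (`T|_M : M → R(T)` is a continuous bijection of Banach spaces, open mapping theorem;
  Kato IV §5.1, the reduced minimum modulus `γ(T) > 0`);
* `exists_forall_finrank_ker_le` — **Kato IV Thm. 5.22, nullity, bounded case**: if moreover
  `ker T` is finite-dimensional (so `T` is upper semi-Fredholm), there is `ε > 0` such that every
  bounded `S` with `‖S - T‖ < ε` has finite-dimensional kernel with `dim ker S ≤ dim ker T`: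
  `ker T` has a closed complement `M` (Hahn–Banach), `ker S ∩ M = 0` as soon as `‖S - T‖ < c`, so
  `ker S` embeds in `E/M ≅ ker T`;
* `eventually_finrank_ker_le` — the same as upper semicontinuity of `S ↦ dim ker S` at `T` for the
  operator-norm topology; `eventually_finrank_ker_le_of_continuousAt` — along a family `P i` of
  operators continuous at `i₀` (Kodaira's setting: a parameter space);
* `finiteDimensional_ker_one_sub_and_isClosed_range`, `eventually_finrank_ker_one_sub_le`,
  `eventually_finrank_ker_one_sub_le_of_continuousAt` — **Kodaira's Thm. 7.3 in resolvent form**: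
  for a compact `K₀`, `1 - K₀` is upper semi-Fredholm (Kato IV Thm. 5.26; here Peetre's lemma,
  `Literature.Analysis.OperatorTheory.peetre`, with the tautological estimate
  `‖u‖ ≤ ‖(1 - K₀)u‖ + ‖K₀ u‖`), so `dim ker (1 - L) ≤ dim ker (1 - K₀)` for `L` near `K₀`, and
  along any norm-continuous family `S i` of operators with `S i₀` compact. For a `C^∞` family of
  formally self-adjoint strongly elliptic operators `E_t ≥ 0` (Kodaira (2005), §7.2) with compact
  resolvents `S_t = (1 + E_t)⁻¹` depending norm-continuously on `t`, `ker E_t = ker (1 - S_t)`,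
  which is how Thm. 7.3 ("`dim 𝔽_t` is upper-semicontinuous") follows; the norm-continuity of
  `t ↦ S_t` is the analytic input left to the consumer.

Scalars: an `RCLike` field (Hahn–Banach). Everything is proved; no definitions, no named facts.

## References

* T. Kato, *Perturbation Theory for Linear Operators*, Springer (1966), Ch. IV §5.1 (reduced
  minimum modulus), §5.3 Thms. 5.22, 5.26. [Kato1966] (held; read PDF pp. 279–289)
* K. Kodaira, *Complex Manifolds and Deformation of Complex Structures*, Springer Classics (2005),
  §7.2 Thms. 7.3, 7.8. [Kodaira2005]
-/

noncomputable section

open Filter Topology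

namespace Literature.Analysis.OperatorTheory

variable {𝕜 : Type*} [RCLike 𝕜] {E F : Type*} [NormedAddCommGroup E] [NormedSpace 𝕜 E]
  [CompleteSpace E] [NormedAddCommGroup F] [NormedSpace 𝕜 F] [CompleteSpace F]

/-- **An operator with closed range is bounded below on a closed complement of its kernel**
(Kato IV §5.1: the reduced minimum modulus `γ(T) = inf ‖Tu‖ / dist(u, ker T)` of a closed
operator with closed range is positive). For `T : E →L[𝕜] F` between Banach spaces with `R(T)`
closed and `M` a closed subspace with `E = ker T ⊕ M`, there is `c > 0` with `c‖x‖ ≤ ‖T x‖` for all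
`x ∈ M`: the restriction `T|_M : M → R(T)` is a continuous linear bijection between Banach spaces,
hence has a bounded inverse (open mapping theorem). [cite: Kato1966, Ch. IV §5.1 Thm. 5.2] -/
theorem exists_bound_of_isCompl_ker (T : E →L[𝕜] F) (hR : IsClosed (T.range : Set F))
    {M : Submodule 𝕜 E} (hM : IsClosed (M : Set E)) (hKM : IsCompl T.ker M) :
    ∃ c : ℝ, 0 < c ∧ ∀ x ∈ M, c * ‖x‖ ≤ ‖T x‖ := by
  haveI : CompleteSpace M := hM.completeSpace_coe
  haveI : CompleteSpace T.range := hR.completeSpace_coe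
  -- `T|_M : M → R(T)`
  let T' : M →L[𝕜] T.range :=
    (T.comp M.subtypeL).codRestrict T.range fun x ↦ LinearMap.mem_range_self _ _
  have hT' : ∀ x : M, (T' x : F) = T x := fun x ↦ rfl
  have hker : T'.ker = ⊥ := by
    rw [LinearMap.ker_eq_bot']
    intro x hx
    have h1 : (x : E) ∈ T.ker := by
      rw [LinearMap.mem_ker]
      have := congrArg Subtype.val hx
      simpa [hT'] using this
    have h2 : (x : E) ∈ T.ker ⊓ M := ⟨h1, x.2⟩
    rw [hKM.inf_eq_bot] at h2
    exact Subtype.ext ((Submodule.mem_bot 𝕜).1 h2)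
  have hrange : T'.range = ⊤ := by
    rw [LinearMap.range_eq_top]
    rintro ⟨y, z, rfl⟩
    have hz : z ∈ T.ker ⊔ M := by rw [hKM.sup_eq_top]; trivial
    obtain ⟨k, hk, m, hm, rfl⟩ := Submodule.mem_sup.1 hz
    refine ⟨⟨m, hm⟩, Subtype.ext ?_⟩
    have hk0 : T k = 0 := hk
    change T m = T (k + m)
    rw [map_add, hk0, zero_add]
  let e : M ≃L[𝕜] T.range := ContinuousLinearEquiv.ofBijective T' hker hrange
  have he : ∀ x : M, (e x : F) = T x := fun x ↦ rfl
  refine ⟨(‖(e.symm : T.range →L[𝕜] M)‖ + 1)⁻¹, by positivity, fun x hx ↦ ?_⟩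
  have h1 : ‖(⟨x, hx⟩ : M)‖ ≤ ‖(e.symm : T.range →L[𝕜] M)‖ * ‖e ⟨x, hx⟩‖ := by
    conv_lhs => rw [← e.symm_apply_apply ⟨x, hx⟩]
    exact (e.symm : T.range →L[𝕜] M).le_opNorm _
  have h2 : ‖e ⟨x, hx⟩‖ = ‖T x‖ := congrArg norm (he ⟨x, hx⟩)
  rw [h2] at h1
  have hx' : ‖(⟨x, hx⟩ : M)‖ = ‖x‖ := rfl
  rw [hx'] at h1
  rw [inv_mul_le_iff₀ (by positivity)]
  nlinarith [norm_nonneg (T x), norm_nonneg x]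

/-- **Kato's first stability theorem, nullity clause (bounded upper-semi-Fredholm case).** Let
`T : E →L[𝕜] F` be a bounded operator between Banach spaces with finite-dimensional kernel and
closed range. Then there is `ε > 0` such that every bounded `S` with `‖S - T‖ < ε` has
finite-dimensional kernel and `dim ker S ≤ dim ker T` (Kato IV Thm. 5.22: "`nul S ≤ nul T`" for
`S = T + A`, `‖A‖ < γ(T)`). Proof: `ker T`, being finite-dimensional, has a closed complement `M`
(Hahn–Banach, `Submodule.ClosedComplemented.of_finiteDimensional`); `T` is bounded below by `c` on
`M` (`exists_bound_of_isCompl_ker`), so for `‖S - T‖ < c` a vector of `ker S ∩ M` satisfies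
`c‖x‖ ≤ ‖Tx‖ = ‖(S - T)x‖ < c‖x‖` unless `x = 0`; hence `ker S → E/M ≅ ker T` is injective.
[cite: Kato1966, Ch. IV §5.3 Thm. 5.22] -/
theorem exists_forall_finrank_ker_le (T : E →L[𝕜] F) [FiniteDimensional 𝕜 T.ker]
    (hR : IsClosed (T.range : Set F)) :
    ∃ ε : ℝ, 0 < ε ∧ ∀ S : E →L[𝕜] F, ‖S - T‖ < ε →
      FiniteDimensional 𝕜 S.ker ∧ Module.finrank 𝕜 S.ker ≤ Module.finrank 𝕜 T.ker := by
  set K := T.ker with hKdef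
  have hKc : K.ClosedComplemented := Submodule.ClosedComplemented.of_finiteDimensional K
  obtain ⟨M, hMc, hKM⟩ := hKc.exists_isClosed_isCompl
  obtain ⟨c, hc, hbound⟩ := exists_bound_of_isCompl_ker T hR hMc hKM
  refine ⟨c, hc, fun S hS ↦ ?_⟩
  -- `ker S ∩ M = 0`
  have hinf : ∀ x ∈ S.ker, x ∈ M → x = 0 := by
    intro x hxS hxM
    by_contra hx
    have hxpos : 0 < ‖x‖ := norm_pos_iff.2 hx
    have h1 : c * ‖x‖ ≤ ‖T x‖ := hbound x hxM
    have hS0 : S x = 0 := hxS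
    have h2 : ‖T x‖ = ‖(S - T) x‖ := by
      rw [FunLike.coe_sub, Pi.sub_apply, hS0, zero_sub, norm_neg]
    have h3 : ‖(S - T) x‖ ≤ ‖S - T‖ * ‖x‖ := (S - T).le_opNorm x
    have h4 : ‖S - T‖ * ‖x‖ < c * ‖x‖ := mul_lt_mul_of_pos_right hS hxpos
    linarith
  -- the injection `ker S → E ⧸ M ≃ ker T`
  let ψ : S.ker →ₗ[𝕜] K :=
    (Submodule.quotientEquivOfIsCompl M K hKM.symm).toLinearMap ∘ₗ M.mkQ ∘ₗ S.ker.subtype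
  have hψ : Function.Injective ψ := by
    rw [← LinearMap.ker_eq_bot, LinearMap.ker_eq_bot']
    intro x hx
    have hx1 : (Submodule.quotientEquivOfIsCompl M K hKM.symm) (M.mkQ (x : E)) = 0 := hx
    have hx' : M.mkQ (x : E) = 0 := (LinearEquiv.map_eq_zero_iff _).1 hx1
    rw [Submodule.mkQ_apply, Submodule.Quotient.mk_eq_zero] at hx'
    exact Subtype.ext (hinf x x.2 hx')
  haveI : FiniteDimensional 𝕜 S.ker := Module.Finite.of_injective ψ hψ
  exact ⟨inferInstance, LinearMap.finrank_le_finrank_of_injective hψ⟩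

/-- **Upper semicontinuity of the nullity** (Kato IV Thm. 5.22, filter form): for a bounded operator
`T` between Banach spaces with finite-dimensional kernel and closed range,
`dim ker S ≤ dim ker T` for all bounded `S` in a neighbourhood of `T` in the operator norm — the
abstract form of Kodaira's Thm. 7.3 ("`dim 𝔽_t` is upper-semicontinuous in `t`") for
norm-continuous families. [cite: Kato1966, Ch. IV §5.3 Thm. 5.22] [cite: Kodaira2005, §7.2 Thm. 7.3] -/
theorem eventually_finrank_ker_le (T : E →L[𝕜] F) [FiniteDimensional 𝕜 T.ker]
    (hR : IsClosed (T.range : Set F)) :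
    ∀ᶠ S in 𝓝 T, Module.finrank 𝕜 S.ker ≤ Module.finrank 𝕜 T.ker := by
  obtain ⟨ε, hε, h⟩ := exists_forall_finrank_ker_le T hR
  rw [Metric.eventually_nhds_iff]
  exact ⟨ε, hε, fun S hS ↦ (h S (by rwa [dist_eq_norm] at hS)).2⟩

/-! ### Along continuous families; the compact (resolvent) form of Kodaira's Thm. 7.3 -/

/-- **Upper semicontinuity of the nullity along a continuous family** (Kato IV Thm. 5.22 composed
with continuity): if `i ↦ P i` is continuous at `i₀` for the operator norm and `P i₀` has
finite-dimensional kernel and closed range, then `dim ker (P i) ≤ dim ker (P i₀)` for `i` near `i₀`.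
[cite: Kato1966, Ch. IV §5.3 Thm. 5.22] [cite: Kodaira2005, §7.2 Thm. 7.3] -/
theorem eventually_finrank_ker_le_of_continuousAt {ι : Type*} [TopologicalSpace ι]
    {P : ι → E →L[𝕜] F} {i₀ : ι} (hP : ContinuousAt P i₀) [FiniteDimensional 𝕜 (P i₀).ker]
    (hR : IsClosed ((P i₀).range : Set F)) :
    ∀ᶠ i in 𝓝 i₀, Module.finrank 𝕜 (P i).ker ≤ Module.finrank 𝕜 (P i₀).ker :=
  hP.eventually (eventually_finrank_ker_le (P i₀) hR)

/-- **`1 - K` is upper semi-Fredholm for `K` compact** (F. Riesz; here read off Peetre's lemma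
`Literature.Analysis.OperatorTheory.peetre` with the estimate `‖u‖ ≤ 1 · (‖(1 - K)u‖ + ‖K u‖)`):
`ker (1 - K)` is finite-dimensional and `1 - K` has closed range.
[cite: Kato1966, Ch. IV §5.3 Thm. 5.26] -/
theorem finiteDimensional_ker_one_sub_and_isClosed_range (K : E →L[𝕜] E)
    (hK : IsCompactOperator K) :
    FiniteDimensional 𝕜 (1 - K).ker ∧ IsClosed ((1 - K).range : Set E) := by
  have hest : ∀ u : E, ‖u‖ ≤ 1 * (‖(1 - K) u‖ + ‖K u‖) := fun u ↦ by
    have hu : (1 - K) u + K u = u := by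
      rw [FunLike.coe_sub, Pi.sub_apply, one_apply_eq_self, sub_add_cancel]
    calc ‖u‖ = ‖(1 - K) u + K u‖ := by rw [hu]
      _ ≤ ‖(1 - K) u‖ + ‖K u‖ := norm_add_le _ _
      _ = 1 * (‖(1 - K) u‖ + ‖K u‖) := (one_mul _).symm
  obtain ⟨hfin, hcl⟩ := peetre (1 - K) hK hest
  refine ⟨hfin, ?_⟩
  rw [LinearMap.coe_range]
  exact hcl

/-- **Kodaira's Thm. 7.3, resolvent form, at one operator**: for a compact operator `K₀` on a
Banach space, `dim ker (1 - L) ≤ dim ker (1 - K₀)` for every bounded `L` in a neighbourhood of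
`K₀` (operator norm) — `1 - K₀` is upper semi-Fredholm
(`finiteDimensional_ker_one_sub_and_isClosed_range`) and `L ↦ 1 - L` is continuous, so
`eventually_finrank_ker_le` applies. [cite: Kodaira2005, §7.2 Thm. 7.3] [cite: Kato1966, Ch. IV §5.3 Thm. 5.22] -/
theorem eventually_finrank_ker_one_sub_le (K₀ : E →L[𝕜] E) (hK : IsCompactOperator K₀) :
    ∀ᶠ L in 𝓝 K₀, Module.finrank 𝕜 (1 - L).ker ≤ Module.finrank 𝕜 (1 - K₀).ker := by
  obtain ⟨hfin, hcl⟩ := finiteDimensional_ker_one_sub_and_isClosed_range K₀ hK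
  haveI := hfin
  have hcont : ContinuousAt (fun L : E →L[𝕜] E ↦ 1 - L) K₀ :=
    (continuous_const.sub continuous_id).continuousAt
  exact hcont.eventually (eventually_finrank_ker_le (1 - K₀) hcl)

/-- **Kodaira's Thm. 7.3, resolvent form, along a family** ("`dim 𝔽_t` is upper-semicontinuous in
`t`"): if `i ↦ S i` is a family of bounded operators on a Banach space, continuous at `i₀` for the
operator norm, with `S i₀` compact, then `dim ker (1 - S i) ≤ dim ker (1 - S i₀)` for `i` near
`i₀`. Applied to the compact resolvents `S_t = (1 + E_t)⁻¹` of a family of non-negative self-adjoint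
elliptic operators (`ker E_t = ker (1 - S_t)`), this is Kodaira's semicontinuity of `dim Ker E_t`,
the input of the upper semicontinuity of the Hodge numbers `h^{p,q}(M_t)` (Kodaira (2005), Thm. 7.8;
Voisin I, Prop. 9.17 and Cor. 9.19). [cite: Kodaira2005, §7.2 Thm. 7.3] -/
theorem eventually_finrank_ker_one_sub_le_of_continuousAt {ι : Type*} [TopologicalSpace ι]
    {S : ι → E →L[𝕜] E} {i₀ : ι} (hS : ContinuousAt S i₀) (hK : IsCompactOperator (S i₀)) :
    ∀ᶠ i in 𝓝 i₀, Module.finrank 𝕜 (1 - S i).ker ≤ Module.finrank 𝕜 (1 - S i₀).ker :=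
  hS.eventually (eventually_finrank_ker_one_sub_le (S i₀) hK)

end Literature.Analysis.OperatorTheory

end
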